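import Summits.QuantumFields.YangMills.Theorems.UV3PinnedStepOrganOfGrowingMassEnvelope
import Summits.QuantumFields.YangMills.Theorems.UV3PinnedStepOrganOfTopPartialIterates
import HarnessLib

/-!
# R3 (cell `ym3-torus`, YM₃ on T³ — a ladder RUNG, NOT d = 4, NOT infinite volume, NOT a mass gap, NOT the Clay problem) — **R-19936-S: THE ORGAN ROW
# (S-ii) `hSii` FROM THE KINEMATIC ROWS hTop ∕ (a)′∀ WITH A RUN-LINEAR EXPONENT «every segment of the family's block averaging ending at the unit torus
# (resp. every partial iterate) pushes Haar to `≤ e^{c₀ + c₁·K}·Haar` at run `K`»** — the composition of ✓`UV3PinnedStepOrganOfTopPartialIterates` (K-21-TOP, w3 g19: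
# hTop with ONE `c` ⟹ `m_K ≤ (K+1)e^{c}`) ∕ ✓`UV3PinnedStepOrganOfPartialIterates` (LEAD K-21: (a)′∀) with ✓`UV3PinnedStepOrganOfGrowingMassEnvelope` (RELAX-hJ: a `K`-linear
# log-envelope is absorbed by the `β^A` slot of the (S-ii) row)

Seat `ym-ust-19936-w5` g18 (WIDTH-5 helper on stmt-QuantumFields-19936 `HistoryTailL`; NO claim on crux ∕ stub ∕ registry).  THEOREMS ONLY (0 `def`, 0 `sorry`);
`--supports stmt-QuantumFields-19936 --as helper`; count-neutral; CONDITIONAL on the v1 (α) socket `AlphaInputsT3AC.Of F 𝔠` and on the displayed row hTop♭ (resp. hPI♭).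

THE POINT.  The v5-candidate display hTop (★★OWNER WORD 68; ✓`…Of.linMassEnvelope_all_of_topHaarPushforward`) reads `∃ c ≥ 0, ∀ K j n, j + n = K →
(dU_j)∘(iterFrom (avT3 F K) j n)⁻¹ ≤ e^{c}·dU_{j+n}` with ONE `c` for every run `K` of the family, and gives `m_K(r,·) ≤ (K+1)·e^{c}` hence `hSii` (K-21 §2, `K+1 ≤ (m+2)β_{K−j}`).
RELAX-hJ (✓`AlphaInputsT3AC.Of.hSii_of_growingMassEnvelope`) shows the (S-ii) row tolerates a `K`-LINEAR log-envelope `e^{A₁ + A₂K}`.  Since `(K+1)·e^{c₀ + c₁K} ≤ e^{c₀⁺ + (|c₁|+1)·K}`,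
the two compose: the WEAKER displays
* hTop♭: `∃ c₀ c₁, ∀ K j n, j + n = K → (dU_j)∘(iterFrom (avT3 F K) j n)⁻¹ ≤ e^{c₀ + c₁·K}·dU_{j+n}` (the top-level letter whose constant may grow LINEARLY WITH THE RUN LENGTH),
* hPI♭: `∃ c₀ c₁, ∀ K ι, ι_{j,j} = dU_j → ι_{j,k+1} = ι_{j,k}∘Ū_k⁻¹ → ∀ j < k ≤ K, ι_{j,k} ≤ e^{c₀ + c₁·K}·dU_k` (the all-levels twin),
already give the `K`-linear envelope hJ♭ for EVERY history (§1; trivial history and v1 floors included — so the U organ's linear door, LEAD K-22, can take the same row with one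
more `β`-power) and hence `hSii` (§2).  In the laundering picture (ideator `ym-r3-idea-2` g17, N08-EML-JACOBIAN §4) the run-linear rows are the BORDERLINE regime «fibre-averaging
contraction `θ = L^{−3}`» (one non-decaying `O(|T₁|)` defect per RG level); the run-uniform rows hTop ∕ (a)′∀ are the regime `θ < L^{−3}`.  hTop ⟹ hTop♭, (a)′∀ ⟹ hPI♭ (§3, `c₁ := 0`).

CONTENTS: §0 `smul_measure_mono`, `succ_mul_exp_le_exp_add` (`(K+1)e^{c} ≤ e^{c+K}`), `max_add_mul_zero_le_abs`; §1 ★★ `AlphaInputsT3AC.Of.growingMassEnvelopeAll_of_growingPartialIterates`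
(hPI♭ ⟹ hJ♭ for every history, pub-ymgap file 27 at run `K`) · ★★ `…Of.growingMassEnvelopeAll_of_growingTopHaarPushforward` (hTop♭ ⟹ hJ♭ for every history, K-21-TOP
✓`massRecAC_le_lin_exp_ae_of_map_iterFrom_le` at run `K`) · the two restrictions to admissible non-trivial histories (hJ♭'s displayed shape); §2 ★★★ `AlphaInputsT3AC.Of.hSii_of_growingPartialIterates`,
★★★ `AlphaInputsT3AC.Of.hSii_of_growingTopHaarPushforward` (⟹ ✓p750864's `hSii` binder VERBATIM, via ✓p753818) and ★★★ `hSii_forall_of_growingTopHaarPushforward` (the `∀ L` binder of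
✓`hPinA_of_pinnedLF`, `γ₁ := 1`); §3 `growingPartialIterates_of_partialIterates`, `growingTopHaarPushforward_of_topHaarPushforward` (monotonicity records).

HONEST SCOPE.  Bookkeeping over landed theorems; hTop♭ ∕ hPI♭ ∕ hTop ∕ (a)′∀ are DISPLAYS, NOT proved (OPEN for `blockAvg ℰp`: its one-step image law is not Haar, lit
`AveragingImageLawGaugeInvariance`); nothing of `hSii`'s organ, `hlf`, `stub_pinnedStep`, `stub_unitEnvelope`, `hP′`, `HistoryTailL` (19936), the rung, d = 4, a mass gap or Clay
is proved here; no summit statement is proved by this seat.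

References: T. Bałaban, Commun. Math. Phys. **102** (1985) 255–275 [Balaban1985UV3] ((2) p.256, (5) p.256, (41) p.266, (67)–(71) p.273); T. Bałaban, Commun. Math. Phys. **98**
(1985) 17–51 [Balaban1985Averaging] ((10), (15) p.19); T. Bałaban, Commun. Math. Phys. **109** (1987) 249–301 [Balaban1987RG1] ((0.11) p.253).
-/

set_option autoImplicit false

noncomputable section

namespace Summit.QuantumFields.YangMills.Theorems.UV3PinnedStepOrganOfGrowingPartialIterates

open MeasureTheory
open scoped BigOperators ENNReal
open Literature.MathematicalPhysics.QuantumFieldTheory.Balaban1983to89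
open Literature.MathematicalPhysics.QuantumFieldTheory.Balaban1983to89.T3ContinuumYM3Torus
open Literature.MathematicalPhysics.QuantumFieldTheory.Balaban1983to89.T3UnitLawDensityEML (ℰp)
open Literature.MathematicalPhysics.QuantumFieldTheory.Balaban1985CMP102
open Literature.MathematicalPhysics.QuantumFieldTheory.Balaban1985CMP102.Setting
open Summit.QuantumFields.Balaban3D.Carriers
open Summit.QuantumFields.Balaban3D.Proofs.Primitives
open Summit.QuantumFields.Balaban3D.Proofs.TowerAC
open Summit.QuantumFields.Balaban3D.Proofs.StandardAC
open Summit.QuantumFields.Balaban3D.Proofs.InputsAC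
open Summit.QuantumFields.Balaban3D.Proofs.MassesAC
open Summit.QuantumFields.YangMills.BalabanUVNodes.N08PartialIteratesSufficiency
open Literature.MathematicalPhysics.QuantumFieldTheory.Balaban1983to89.T4AvgSensitivity (iterFrom)
open Summit.QuantumFields.YangMills.Theorems.UV3PinnedStepOrganOfTopPartialIterates (massRecAC_le_lin_exp_ae_of_map_iterFrom_le)

/-! ## §0 Scalar bookkeeping -/

/-- Scalar multiples of a measure are monotone in the scalar. [folklore] -/
theorem smul_measure_mono {α : Type*} [MeasurableSpace α] {a b : ℝ≥0∞} (h : a ≤ b) (μ : Measure α) : a • μ ≤ b • μ := by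
  rw [Measure.le_iff]
  intro s _
  simp only [Measure.smul_apply, smul_eq_mul]
  exact mul_le_mul' h le_rfl

/-- `(K+1)·e^{c} ≤ e^{c+K}` (`K + 1 ≤ e^{K}`). [folklore] -/
theorem succ_mul_exp_le_exp_add (c : ℝ) (K : ℕ) : ((K : ℝ) + 1) * Real.exp c ≤ Real.exp (c + K) := by
  rw [Real.exp_add, mul_comm]
  exact mul_le_mul_of_nonneg_left (Real.add_one_le_exp (K : ℝ)) (Real.exp_pos c).le

/-- `max (c₀ + c₁·K) 0 ≤ |c₀| + |c₁|·K`. [folklore] -/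
theorem max_add_mul_zero_le_abs (c₀ c₁ : ℝ) (K : ℕ) : max (c₀ + c₁ * (K : ℝ)) 0 ≤ |c₀| + |c₁| * (K : ℝ) := by
  have hK : (0 : ℝ) ≤ K := Nat.cast_nonneg K
  refine max_le ?_ (by positivity)
  have h1 : c₁ * (K : ℝ) ≤ |c₁| * (K : ℝ) := mul_le_mul_of_nonneg_right (le_abs_self c₁) hK
  linarith [le_abs_self c₀]

variable {F : T3Family} {𝔠 : AlphaConsts F.L (suGroupModel 2).N}

/-! ## §1 (a)′∀ with a run-linear exponent ⟹ the `K`-linear log-envelope hJ♭, every history -/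

/-- ★★ **hPI♭ ⟹ THE `K`-LINEAR MASS ENVELOPE FOR EVERY HISTORY** (trivial history and the v1 floors included): if at every run `K` every partial iterated
push-forward of Haar under the family's pinned block averaging `avT3 F K` obeys `ι_{j,k} ≤ e^{c₀ + c₁·K}·dU_k` (`j < k ≤ K`), then `m_K(r,·) ≤ e^{A₁ + A₂·K}` `dV_K`-a.e. with
`A₁ := |c₀|`, `A₂ := |c₁| + 1` — pub-ymgap file 27 at run `K` with the constant `max (c₀ + c₁K) 0`, then `(K+1)·e^{c} ≤ e^{c+K}`; the package's averaging IS `avT3 F K` and its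
masses ARE `massRecAC` (`rfl`, as in K-21 §3). [cite: Balaban1985UV3, (41) p.266 + (2) p.256 + (5) p.256; Balaban1985Averaging, (15) p.19] -/
theorem _root_.Summit.QuantumFields.YangMills.Theorems.AlphaInputsT3AC.Of.growingMassEnvelopeAll_of_growingPartialIterates (h : AlphaInputsT3AC.Of F 𝔠)
    (γ : ℝ) (hγ : 0 < γ) (hγ1 : γ ≤ (min 𝔠.gamma0 1) ^ 2)
    (hPI : ∃ c₀ c₁ : ℝ, ∀ (K : ℕ) (ι : ∀ j k : ℕ, Measure (GaugeField (F.P K) k (Matrix.specialUnitaryGroup (Fin 2) ℂ))),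
      (∀ j, ι j j = fieldMeasure (F.P K) j (Matrix.specialUnitaryGroup (Fin 2) ℂ)) →
      (∀ j k, j ≤ k → ι j (k + 1) = (ι j k).map (avT3 F K k).avg) →
      ∀ j k, j < k → k ≤ K → ι j k ≤ ENNReal.ofReal (Real.exp (c₀ + c₁ * (K : ℝ))) • fieldMeasure (F.P K) k (Matrix.specialUnitaryGroup (Fin 2) ℂ)) :
    ∃ A₁ A₂ : ℝ, ∀ (K : ℕ) (r : Hist (F.P K) K),
      ∀ᵐ W ∂(fieldMeasure (F.P K) K (Matrix.specialUnitaryGroup (Fin 2) ℂ)),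
        (inputOfAC 𝔠.lane (h.pkgAt γ hγ hγ1 K).X (h.pkgAt γ hγ hγ1 K).𝔖).W.mass K r W ≤ Real.exp (A₁ + A₂ * K) := by
  obtain ⟨c₀, c₁, hc⟩ := hPI
  refine ⟨|c₀|, |c₁| + 1, fun K r => ?_⟩
  set cK : ℝ := max (c₀ + c₁ * (K : ℝ)) 0 with hcK
  have hcK0 : 0 ≤ cK := le_max_right _ _
  obtain ⟨ι, hι0, hιs⟩ := exists_partialIterates (avT3 F K)
  have hbound : ∀ j k, j < k → k ≤ K →
      ι j k ≤ ENNReal.ofReal (Real.exp cK) • fieldMeasure (F.P K) k (Matrix.specialUnitaryGroup (Fin 2) ℂ) :=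
    fun j k hjk hkK => (hc K ι hι0 hιs j k hjk hkK).trans
      (smul_measure_mono (ENNReal.ofReal_le_ofReal (Real.exp_le_exp.mpr (le_max_left _ _))) _)
  have key := massRecAC_le_exp_mul_ae_of_partialIterates_le 𝔠.lane.carrier.M₁
    (rcolOf (T3Scales F γ hγ (hγ1.trans (sq_min_one_le _ 𝔠.gamma0_pos)) K) 𝔠.lane.carrier)
    (eps1Of (T3Scales F γ hγ (hγ1.trans (sq_min_one_le _ 𝔠.gamma0_pos)) K) 𝔠.lane.carrier)
    (epsSOf (T3Scales F γ hγ (hγ1.trans (sq_min_one_le _ 𝔠.gamma0_pos)) K) 𝔠.lane.carrier)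
    (avT3 F K) (avgAC_avT3 F K) ι hι0 hιs K (fun _ => cK) (fun _ => hcK0) hbound K le_rfl r
  filter_upwards [key] with W hW
  refine hW.trans ((succ_mul_exp_le_exp_add cK K).trans (Real.exp_le_exp.mpr ?_))
  have := max_add_mul_zero_le_abs c₀ c₁ K
  linarith

/-- ★★ **hPI♭ ⟹ hJ♭ IN ITS DISPLAYED SHAPE** (admissible non-trivial histories; the special case ✓p753818 `hSii_of_growingMassEnvelope` consumes).
[cite: Balaban1985UV3, (41) p.266 + (2) p.256 + (5) p.256; Balaban1985Averaging, (15) p.19] -/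
theorem _root_.Summit.QuantumFields.YangMills.Theorems.AlphaInputsT3AC.Of.growingMassEnvelope_of_growingPartialIterates (h : AlphaInputsT3AC.Of F 𝔠)
    (γ : ℝ) (hγ : 0 < γ) (hγ1 : γ ≤ (min 𝔠.gamma0 1) ^ 2)
    (hPI : ∃ c₀ c₁ : ℝ, ∀ (K : ℕ) (ι : ∀ j k : ℕ, Measure (GaugeField (F.P K) k (Matrix.specialUnitaryGroup (Fin 2) ℂ))),
      (∀ j, ι j j = fieldMeasure (F.P K) j (Matrix.specialUnitaryGroup (Fin 2) ℂ)) →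
      (∀ j k, j ≤ k → ι j (k + 1) = (ι j k).map (avT3 F K k).avg) →
      ∀ j k, j < k → k ≤ K → ι j k ≤ ENNReal.ofReal (Real.exp (c₀ + c₁ * (K : ℝ))) • fieldMeasure (F.P K) k (Matrix.specialUnitaryGroup (Fin 2) ℂ)) :
    ∃ A₁ A₂ : ℝ, ∀ (K : ℕ) (r : Hist (F.P K) K),
      Hist.Admissible 𝔠.lane.carrier.M₁ (rcolOf (T3Scales F γ hγ (hγ1.trans (sq_min_one_le _ 𝔠.gamma0_pos)) K) 𝔠.lane.carrier) K r →
      r ≠ Hist.triv (F.P K) K →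
      ∀ᵐ W ∂(fieldMeasure (F.P K) K (Matrix.specialUnitaryGroup (Fin 2) ℂ)),
        (inputOfAC 𝔠.lane (h.pkgAt γ hγ hγ1 K).X (h.pkgAt γ hγ hγ1 K).𝔖).W.mass K r W ≤ Real.exp (A₁ + A₂ * K) := by
  obtain ⟨A₁, A₂, hA⟩ := h.growingMassEnvelopeAll_of_growingPartialIterates γ hγ hγ1 hPI
  exact ⟨A₁, A₂, fun K r _ _ => hA K r⟩

/-- ★★ **hTop♭ ⟹ THE `K`-LINEAR MASS ENVELOPE FOR EVERY HISTORY**: if at every run `K` every segment of the family's pinned block averaging ending at the unit torus pushes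
Haar to at most `e^{c₀ + c₁·K}`·Haar, `(dU_j)∘(iterFrom (avT3 F K) j n)⁻¹ ≤ e^{c₀ + c₁·K}·dU_{j+n}` (`j + n = K`), then `m_K(r,·) ≤ e^{|c₀| + (|c₁|+1)·K}` `dV_K`-a.e., every history —
K-21-TOP's ✓`massRecAC_le_lin_exp_ae_of_map_iterFrom_le` at run `K` with the constant `max (c₀ + c₁K) 0`, then `(K+1)e^{c} ≤ e^{c+K}`.
[cite: Balaban1985UV3, (41) p.266 + (2) p.256 + (5) p.256; Balaban1985Averaging, (15) p.19; Balaban1987RG1, (0.11) p.253] -/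
theorem _root_.Summit.QuantumFields.YangMills.Theorems.AlphaInputsT3AC.Of.growingMassEnvelopeAll_of_growingTopHaarPushforward (h : AlphaInputsT3AC.Of F 𝔠)
    (γ : ℝ) (hγ : 0 < γ) (hγ1 : γ ≤ (min 𝔠.gamma0 1) ^ 2)
    (hTop : ∃ c₀ c₁ : ℝ, ∀ (K j n : ℕ), j + n = K →
      (fieldMeasure (F.P K) j (Matrix.specialUnitaryGroup (Fin 2) ℂ)).map (iterFrom (avT3 F K) j n) ≤
        ENNReal.ofReal (Real.exp (c₀ + c₁ * (K : ℝ))) • fieldMeasure (F.P K) (j + n) (Matrix.specialUnitaryGroup (Fin 2) ℂ)) :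
    ∃ A₁ A₂ : ℝ, ∀ (K : ℕ) (r : Hist (F.P K) K),
      ∀ᵐ W ∂(fieldMeasure (F.P K) K (Matrix.specialUnitaryGroup (Fin 2) ℂ)),
        (inputOfAC 𝔠.lane (h.pkgAt γ hγ hγ1 K).X (h.pkgAt γ hγ hγ1 K).𝔖).W.mass K r W ≤ Real.exp (A₁ + A₂ * K) := by
  obtain ⟨c₀, c₁, hc⟩ := hTop
  refine ⟨|c₀|, |c₁| + 1, fun K r => ?_⟩
  set cK : ℝ := max (c₀ + c₁ * (K : ℝ)) 0 with hcK
  have hcK0 : 0 ≤ cK := le_max_right _ _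
  have hbound : ∀ j n : ℕ, j + n = K →
      (fieldMeasure (F.P K) j (Matrix.specialUnitaryGroup (Fin 2) ℂ)).map (iterFrom (avT3 F K) j n) ≤
        ENNReal.ofReal (Real.exp cK) • fieldMeasure (F.P K) (j + n) (Matrix.specialUnitaryGroup (Fin 2) ℂ) :=
    fun j n hjn => (hc K j n hjn).trans
      (smul_measure_mono (ENNReal.ofReal_le_ofReal (Real.exp_le_exp.mpr (le_max_left _ _))) _)
  have key := massRecAC_le_lin_exp_ae_of_map_iterFrom_le 𝔠.lane.carrier.M₁
    (rcolOf (T3Scales F γ hγ (hγ1.trans (sq_min_one_le _ 𝔠.gamma0_pos)) K) 𝔠.lane.carrier)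
    (eps1Of (T3Scales F γ hγ (hγ1.trans (sq_min_one_le _ 𝔠.gamma0_pos)) K) 𝔠.lane.carrier)
    (epsSOf (T3Scales F γ hγ (hγ1.trans (sq_min_one_le _ 𝔠.gamma0_pos)) K) 𝔠.lane.carrier)
    (avT3 F K) (avgAC_avT3 F K) K cK hcK0 hbound r
  filter_upwards [key] with W hW
  refine hW.trans ((succ_mul_exp_le_exp_add cK K).trans (Real.exp_le_exp.mpr ?_))
  have := max_add_mul_zero_le_abs c₀ c₁ K
  linarith

/-- ★★ **hTop♭ ⟹ hJ♭ IN ITS DISPLAYED SHAPE** (admissible non-trivial histories). [cite: Balaban1985UV3, (41) p.266 + (2) p.256; Balaban1987RG1, (0.11) p.253] -/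
theorem _root_.Summit.QuantumFields.YangMills.Theorems.AlphaInputsT3AC.Of.growingMassEnvelope_of_growingTopHaarPushforward (h : AlphaInputsT3AC.Of F 𝔠)
    (γ : ℝ) (hγ : 0 < γ) (hγ1 : γ ≤ (min 𝔠.gamma0 1) ^ 2)
    (hTop : ∃ c₀ c₁ : ℝ, ∀ (K j n : ℕ), j + n = K →
      (fieldMeasure (F.P K) j (Matrix.specialUnitaryGroup (Fin 2) ℂ)).map (iterFrom (avT3 F K) j n) ≤
        ENNReal.ofReal (Real.exp (c₀ + c₁ * (K : ℝ))) • fieldMeasure (F.P K) (j + n) (Matrix.specialUnitaryGroup (Fin 2) ℂ)) :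
    ∃ A₁ A₂ : ℝ, ∀ (K : ℕ) (r : Hist (F.P K) K),
      Hist.Admissible 𝔠.lane.carrier.M₁ (rcolOf (T3Scales F γ hγ (hγ1.trans (sq_min_one_le _ 𝔠.gamma0_pos)) K) 𝔠.lane.carrier) K r →
      r ≠ Hist.triv (F.P K) K →
      ∀ᵐ W ∂(fieldMeasure (F.P K) K (Matrix.specialUnitaryGroup (Fin 2) ℂ)),
        (inputOfAC 𝔠.lane (h.pkgAt γ hγ hγ1 K).X (h.pkgAt γ hγ hγ1 K).𝔖).W.mass K r W ≤ Real.exp (A₁ + A₂ * K) := by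
  obtain ⟨A₁, A₂, hA⟩ := h.growingMassEnvelopeAll_of_growingTopHaarPushforward γ hγ hγ1 hTop
  exact ⟨A₁, A₂, fun K r _ _ => hA K r⟩

/-! ## §2 ⟹ the (S-ii) row of record, per family and under the `∀ L` binder -/

open Classical in
/-- ★★★ **THE ORGAN ROW (S-ii) `hSii` (✓p750864's binder VERBATIM) FROM THE (α) SOCKET AND hPI♭ ALONE** (per family, coupling in the window, depth `m > 0`): §1 then
✓p753818 `hSii_of_growingMassEnvelope`.  With ✓p750864 and ✓p749772: `stub_pinnedStep` ⟸ v1 socket + `hMain` + hPI♭[`blockAvg ℰp`].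
[cite: Balaban1985UV3, (41) p.266, (67)–(71) p.273, (2) p.256, (5) p.256] -/
theorem _root_.Summit.QuantumFields.YangMills.Theorems.AlphaInputsT3AC.Of.hSii_of_growingPartialIterates (h : AlphaInputsT3AC.Of F 𝔠)
    (γ : ℝ) (hγ : 0 < γ) (hγ1 : γ ≤ (min 𝔠.gamma0 1) ^ 2) {m : ℕ} (hm : 0 < m)
    (hPI : ∃ c₀ c₁ : ℝ, ∀ (K : ℕ) (ι : ∀ j k : ℕ, Measure (GaugeField (F.P K) k (Matrix.specialUnitaryGroup (Fin 2) ℂ))),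
      (∀ j, ι j j = fieldMeasure (F.P K) j (Matrix.specialUnitaryGroup (Fin 2) ℂ)) →
      (∀ j k, j ≤ k → ι j (k + 1) = (ι j k).map (avT3 F K k).avg) →
      ∀ j k, j < k → k ≤ K → ι j k ≤ ENNReal.ofReal (Real.exp (c₀ + c₁ * (K : ℝ))) • fieldMeasure (F.P K) k (Matrix.specialUnitaryGroup (Fin 2) ℂ)) :
    ∃ (CZ c : ℝ) (A : ℕ), 0 < c ∧
      ∀ (K j : ℕ) (hj1 : 1 ≤ j) (hjK : j + 2 ≤ K), j + (K - 1) / m ≤ K → ∀ (a : Plaq (F.P K) j),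
        ∀ᵐ W ∂(fieldMeasure (F.P K) K (Matrix.specialUnitaryGroup (Fin 2) ℂ)),
        ∑ r ∈ Finset.univ.filter (fun r : Hist (F.P K) K =>
            a ∈ r ⟨j, by omega⟩ ∨ ¬ plaqCover a ⊆ Omega 𝔠.lane.carrier.M₁
              (rcolOf (T3Scales F γ hγ (hγ1.trans (sq_min_one_le _ 𝔠.gamma0_pos)) K) 𝔠.lane.carrier) j
              (fun i : Fin j => r (Fin.castLE (by omega) i)) j),
          (inputOfAC 𝔠.lane (h.pkgAt γ hγ hγ1 K).X (h.pkgAt γ hγ hγ1 K).𝔖).W.mass K r W *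
            Real.exp (-((h.pkgAt γ hγ hγ1 K).T.mainT K r W) + (h.pkgAt γ hγ hγ1 K).T.Zterm K r) ≤
        Real.exp CZ * ((F.scheme ℰp γ).β (K - j) ^ A *
          Real.exp (-(c * B10.pFun 𝔠.b₀ 𝔠.p₀ (Real.sqrt (γ * ((F.L : ℝ)⁻¹) ^ (K - j))) ^ 2))) :=
  h.hSii_of_growingMassEnvelope γ hγ hγ1 hm (h.growingMassEnvelope_of_growingPartialIterates γ hγ hγ1 hPI)

open Classical in
/-- ★★★ **THE ORGAN ROW (S-ii) `hSii` (✓p750864's binder VERBATIM) FROM THE (α) SOCKET AND hTop♭ ALONE** (per family, coupling in the window, depth `m > 0`): §1 then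
✓p753818 `hSii_of_growingMassEnvelope`.  With ✓p750864 and the guarded S-face ✓p753437: `stub_pinnedStep` ⟸ v1 socket + `hMain` + hTop♭[`blockAvg ℰp`].
[cite: Balaban1985UV3, (41) p.266, (67)–(71) p.273, (2) p.256, (5) p.256; Balaban1987RG1, (0.11) p.253] -/
theorem _root_.Summit.QuantumFields.YangMills.Theorems.AlphaInputsT3AC.Of.hSii_of_growingTopHaarPushforward (h : AlphaInputsT3AC.Of F 𝔠)
    (γ : ℝ) (hγ : 0 < γ) (hγ1 : γ ≤ (min 𝔠.gamma0 1) ^ 2) {m : ℕ} (hm : 0 < m)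
    (hTop : ∃ c₀ c₁ : ℝ, ∀ (K j n : ℕ), j + n = K →
      (fieldMeasure (F.P K) j (Matrix.specialUnitaryGroup (Fin 2) ℂ)).map (iterFrom (avT3 F K) j n) ≤
        ENNReal.ofReal (Real.exp (c₀ + c₁ * (K : ℝ))) • fieldMeasure (F.P K) (j + n) (Matrix.specialUnitaryGroup (Fin 2) ℂ)) :
    ∃ (CZ c : ℝ) (A : ℕ), 0 < c ∧
      ∀ (K j : ℕ) (hj1 : 1 ≤ j) (hjK : j + 2 ≤ K), j + (K - 1) / m ≤ K → ∀ (a : Plaq (F.P K) j),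
        ∀ᵐ W ∂(fieldMeasure (F.P K) K (Matrix.specialUnitaryGroup (Fin 2) ℂ)),
        ∑ r ∈ Finset.univ.filter (fun r : Hist (F.P K) K =>
            a ∈ r ⟨j, by omega⟩ ∨ ¬ plaqCover a ⊆ Omega 𝔠.lane.carrier.M₁
              (rcolOf (T3Scales F γ hγ (hγ1.trans (sq_min_one_le _ 𝔠.gamma0_pos)) K) 𝔠.lane.carrier) j
              (fun i : Fin j => r (Fin.castLE (by omega) i)) j),
          (inputOfAC 𝔠.lane (h.pkgAt γ hγ hγ1 K).X (h.pkgAt γ hγ hγ1 K).𝔖).W.mass K r W *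
            Real.exp (-((h.pkgAt γ hγ hγ1 K).T.mainT K r W) + (h.pkgAt γ hγ hγ1 K).T.Zterm K r) ≤
        Real.exp CZ * ((F.scheme ℰp γ).β (K - j) ^ A *
          Real.exp (-(c * B10.pFun 𝔠.b₀ 𝔠.p₀ (Real.sqrt (γ * ((F.L : ℝ)⁻¹) ^ (K - j))) ^ 2))) :=
  h.hSii_of_growingMassEnvelope γ hγ hγ1 hm (h.growingMassEnvelope_of_growingTopHaarPushforward γ hγ hγ1 hTop)

open Classical in
/-- ★★★ **THE `∀ L`-BINDER `hSii` OF ✓`UV3PinnedStepKnitOfPackage.hPinA_of_pinnedLF` ∕ ✓p751371 ∕ ✓p753437 FROM THE SOCKETS AND hTop♭ PER FAMILY** (threshold `γ₁ := 1`),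
family by family from `hSii_of_growingTopHaarPushforward` — the twin of K-21-TOP-KNIT's `hSii_forall_of_topHaarPushforward` under the weaker run-linear row.
[cite: Balaban1985UV3, (41) p.266, (67)–(71) p.273, (5) p.256; Balaban1987RG1, (0.11) p.253] -/
theorem hSii_forall_of_growingTopHaarPushforward
    (hTop : ∀ F : T3Family, ∃ c₀ c₁ : ℝ, ∀ (K j n : ℕ), j + n = K →
      (fieldMeasure (F.P K) j (Matrix.specialUnitaryGroup (Fin 2) ℂ)).map (iterFrom (avT3 F K) j n) ≤
        ENNReal.ofReal (Real.exp (c₀ + c₁ * (K : ℝ))) • fieldMeasure (F.P K) (j + n) (Matrix.specialUnitaryGroup (Fin 2) ℂ)) :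
    ∀ (L : ℕ) (𝔠 : AlphaConsts L (suGroupModel 2).N)
      (hOf : ∀ (F : T3Family) (hF : F.L = L), AlphaInputsT3AC.Of F (hF ▸ 𝔠)),
        ∀ (m : ℕ), 0 < m →
          ∃ γ₁ : ℝ, 0 < γ₁ ∧ ∀ (F : T3Family) (hF : F.L = L)
            (γ : ℝ) (hγ : 0 < γ) (hγ1' : γ ≤ (min (hF ▸ 𝔠).gamma0 1) ^ 2), γ ≤ γ₁ →
            ∃ (CZ c : ℝ) (A : ℕ), 0 < c ∧
              ∀ (K j : ℕ) (hj1 : 1 ≤ j) (hjK : j + 2 ≤ K), j + (K - 1) / m ≤ K → ∀ (a : Plaq (F.P K) j),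
                ∀ᵐ W ∂(fieldMeasure (F.P K) K (Matrix.specialUnitaryGroup (Fin 2) ℂ)),
                ∑ r ∈ Finset.univ.filter (fun r : Hist (F.P K) K =>
                    a ∈ r ⟨j, by omega⟩ ∨ ¬ plaqCover a ⊆ Omega (hF ▸ 𝔠).lane.carrier.M₁
                      (rcolOf (T3Scales F γ hγ (hγ1'.trans (sq_min_one_le _ (hF ▸ 𝔠).gamma0_pos)) K) (hF ▸ 𝔠).lane.carrier) j
                      (fun i : Fin j => r (Fin.castLE (by omega) i)) j),
                  (inputOfAC (hF ▸ 𝔠).lane ((hOf F hF).pkgAt γ hγ hγ1' K).X ((hOf F hF).pkgAt γ hγ hγ1' K).𝔖).W.mass K r W *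
                    Real.exp (-(((hOf F hF).pkgAt γ hγ hγ1' K).T.mainT K r W) + ((hOf F hF).pkgAt γ hγ hγ1' K).T.Zterm K r) ≤
                Real.exp CZ * ((F.scheme ℰp γ).β (K - j) ^ A *
                  Real.exp (-(c * B10.pFun (hF ▸ 𝔠).b₀ (hF ▸ 𝔠).p₀ (Real.sqrt (γ * ((F.L : ℝ)⁻¹) ^ (K - j))) ^ 2))) :=
  fun _ _ hOf _ hm => ⟨1, one_pos, fun F hF γ hγ hγ1' _ => (hOf F hF).hSii_of_growingTopHaarPushforward γ hγ hγ1' hm (hTop F)⟩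

open Classical in
/-- ★★★ **THE `∀ L`-BINDER `hSii` OF ✓`UV3PinnedStepKnitOfPackage.hPinA_of_pinnedLF` FROM THE SOCKETS AND hPI♭ PER FAMILY** (threshold `γ₁ := 1`), family by family
from `hSii_of_growingPartialIterates` — the twin of K-21's ✓`hSii_forall_of_partialIterates` under the weaker run-linear row. [cite: Balaban1985UV3, (41) p.266, (67)–(71) p.273, (5) p.256] -/
theorem hSii_forall_of_growingPartialIterates
    (hPI : ∀ F : T3Family, ∃ c₀ c₁ : ℝ,
      ∀ (K : ℕ) (ι : ∀ j k : ℕ, Measure (GaugeField (F.P K) k (Matrix.specialUnitaryGroup (Fin 2) ℂ))),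
      (∀ j, ι j j = fieldMeasure (F.P K) j (Matrix.specialUnitaryGroup (Fin 2) ℂ)) →
      (∀ j k, j ≤ k → ι j (k + 1) = (ι j k).map (avT3 F K k).avg) →
      ∀ j k, j < k → k ≤ K → ι j k ≤ ENNReal.ofReal (Real.exp (c₀ + c₁ * (K : ℝ))) • fieldMeasure (F.P K) k (Matrix.specialUnitaryGroup (Fin 2) ℂ)) :
    ∀ (L : ℕ) (𝔠 : AlphaConsts L (suGroupModel 2).N)
      (hOf : ∀ (F : T3Family) (hF : F.L = L), AlphaInputsT3AC.Of F (hF ▸ 𝔠)),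
        ∀ (m : ℕ), 0 < m →
          ∃ γ₁ : ℝ, 0 < γ₁ ∧ ∀ (F : T3Family) (hF : F.L = L)
            (γ : ℝ) (hγ : 0 < γ) (hγ1' : γ ≤ (min (hF ▸ 𝔠).gamma0 1) ^ 2), γ ≤ γ₁ →
            ∃ (CZ c : ℝ) (A : ℕ), 0 < c ∧
              ∀ (K j : ℕ) (hj1 : 1 ≤ j) (hjK : j + 2 ≤ K), j + (K - 1) / m ≤ K → ∀ (a : Plaq (F.P K) j),
                ∀ᵐ W ∂(fieldMeasure (F.P K) K (Matrix.specialUnitaryGroup (Fin 2) ℂ)),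
                ∑ r ∈ Finset.univ.filter (fun r : Hist (F.P K) K =>
                    a ∈ r ⟨j, by omega⟩ ∨ ¬ plaqCover a ⊆ Omega (hF ▸ 𝔠).lane.carrier.M₁
                      (rcolOf (T3Scales F γ hγ (hγ1'.trans (sq_min_one_le _ (hF ▸ 𝔠).gamma0_pos)) K) (hF ▸ 𝔠).lane.carrier) j
                      (fun i : Fin j => r (Fin.castLE (by omega) i)) j),
                  (inputOfAC (hF ▸ 𝔠).lane ((hOf F hF).pkgAt γ hγ hγ1' K).X ((hOf F hF).pkgAt γ hγ hγ1' K).𝔖).W.mass K r W *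
                    Real.exp (-(((hOf F hF).pkgAt γ hγ hγ1' K).T.mainT K r W) + ((hOf F hF).pkgAt γ hγ hγ1' K).T.Zterm K r) ≤
                Real.exp CZ * ((F.scheme ℰp γ).β (K - j) ^ A *
                  Real.exp (-(c * B10.pFun (hF ▸ 𝔠).b₀ (hF ▸ 𝔠).p₀ (Real.sqrt (γ * ((F.L : ℝ)⁻¹) ^ (K - j))) ^ 2))) :=
  fun _ _ hOf _ hm => ⟨1, one_pos, fun F hF γ hγ hγ1' _ => (hOf F hF).hSii_of_growingPartialIterates γ hγ hγ1' hm (hPI F)⟩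

/-! ## §3 Monotonicity records: (a)′∀ ⟹ hPI♭, hTop ⟹ hTop♭ -/

/-- **hPI ⟹ hPI♭**: K-21's run-uniform row (a)′∀ implies the run-linear row (`c₁ := 0`). [folklore] -/
theorem growingPartialIterates_of_partialIterates (F : T3Family)
    (hPI : ∃ c : ℝ, 0 ≤ c ∧ ∀ (K : ℕ) (ι : ∀ j k : ℕ, Measure (GaugeField (F.P K) k (Matrix.specialUnitaryGroup (Fin 2) ℂ))),
      (∀ j, ι j j = fieldMeasure (F.P K) j (Matrix.specialUnitaryGroup (Fin 2) ℂ)) →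
      (∀ j k, j ≤ k → ι j (k + 1) = (ι j k).map (avT3 F K k).avg) →
      ∀ j k, j < k → k ≤ K → ι j k ≤ ENNReal.ofReal (Real.exp c) • fieldMeasure (F.P K) k (Matrix.specialUnitaryGroup (Fin 2) ℂ)) :
    ∃ c₀ c₁ : ℝ, ∀ (K : ℕ) (ι : ∀ j k : ℕ, Measure (GaugeField (F.P K) k (Matrix.specialUnitaryGroup (Fin 2) ℂ))),
      (∀ j, ι j j = fieldMeasure (F.P K) j (Matrix.specialUnitaryGroup (Fin 2) ℂ)) →
      (∀ j k, j ≤ k → ι j (k + 1) = (ι j k).map (avT3 F K k).avg) →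
      ∀ j k, j < k → k ≤ K → ι j k ≤ ENNReal.ofReal (Real.exp (c₀ + c₁ * (K : ℝ))) • fieldMeasure (F.P K) k (Matrix.specialUnitaryGroup (Fin 2) ℂ) := by
  obtain ⟨c, _, hc⟩ := hPI
  refine ⟨c, 0, fun K ι hι0 hιs j k hjk hkK => ?_⟩
  rw [zero_mul, add_zero]
  exact hc K ι hι0 hιs j k hjk hkK

/-- **hTop ⟹ hTop♭**: K-21-TOP's run-uniform top-level row implies the run-linear one (`c₁ := 0`). [folklore] -/
theorem growingTopHaarPushforward_of_topHaarPushforward (F : T3Family)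
    (hTop : ∃ c : ℝ, 0 ≤ c ∧ ∀ (K j n : ℕ), j + n = K →
      (fieldMeasure (F.P K) j (Matrix.specialUnitaryGroup (Fin 2) ℂ)).map (iterFrom (avT3 F K) j n) ≤
        ENNReal.ofReal (Real.exp c) • fieldMeasure (F.P K) (j + n) (Matrix.specialUnitaryGroup (Fin 2) ℂ)) :
    ∃ c₀ c₁ : ℝ, ∀ (K j n : ℕ), j + n = K →
      (fieldMeasure (F.P K) j (Matrix.specialUnitaryGroup (Fin 2) ℂ)).map (iterFrom (avT3 F K) j n) ≤
        ENNReal.ofReal (Real.exp (c₀ + c₁ * (K : ℝ))) • fieldMeasure (F.P K) (j + n) (Matrix.specialUnitaryGroup (Fin 2) ℂ) := by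
  obtain ⟨c, _, hc⟩ := hTop
  refine ⟨c, 0, fun K j n hjn => ?_⟩
  rw [zero_mul, add_zero]
  exact hc K j n hjn

end Summit.QuantumFields.YangMills.Theorems.UV3PinnedStepOrganOfGrowingPartialIterates

end
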